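import Summits.QuantumAdvantage.QuantumAdvantage.Theses.MobiusLadder

/-!
# Route `MobiusLadder`, assembly item `Assembly` (stmt-QuantumAdvantage-1402)

`Assembly := LiouvilleMemBQP → LiouvilleNotPPoly → QuantumAdvantage`: the Liouville language
`L_λ = {bin(N) : λ(N) = −1}` in `BQP` together with thesis X (`L_λ ∉ P/poly`) gives the summit
`QuantumAdvantage := ∃ L, L ∈ BQP ∧ L ∉ BPP`.

Proof (one line of classical logic through Adleman's theorem, PROVED in the tree as
`Literature.Computability.Complexity.BPP_subset_PPoly_holds`): if no BQP language leaves BPP, then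
`L_λ ∈ BQP` forces `L_λ ∈ BPP ⊆ P/poly`, contradicting X. No new definitions.
-/

set_option linter.dupNamespace false -- D-0017: single-problem summit ⇒ `QuantumAdvantage.QuantumAdvantage` by design

namespace Summit.QuantumAdvantage.QuantumAdvantage.Theorems.MobiusLadder

/-- **Assembly of route `MobiusLadder`** (stmt-QuantumAdvantage-1402): `L_λ ∈ BQP` and
`L_λ ∉ P/poly` imply `QuantumAdvantage` (`∃ L, L ∈ BQP ∧ L ∉ BPP`). By contradiction on the
existential summit: otherwise `L_λ ∈ BPP`, hence `L_λ ∈ P/poly` by Adleman's theorem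
`BPP ⊆ P/poly` (Adleman 1978; Arora–Barak 2009, Thm. 7.14; tree:
`Literature.Computability.Complexity.BPP_subset_PPoly_holds`). [cite: Adleman1978]
[cite: AroraBarakCC2009, Thm. 7.14] -/
theorem Assembly_proof :
    Summit.QuantumAdvantage.QuantumAdvantage.Theses.MobiusLadder.Assembly := by
  unfold Summit.QuantumAdvantage.QuantumAdvantage.Theses.MobiusLadder.Assembly
  intro hBQP hX
  by_contra h
  exact hX (Literature.Computability.Complexity.BPP_subset_PPoly_holds
    (by_contra fun hL => h ⟨_, hBQP, hL⟩))

end Summit.QuantumAdvantage.QuantumAdvantage.Theorems.MobiusLadder
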